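import Literature.NumberTheory.Sieve.LinearEquationsInPrimesDivisorMoments
import Mathlib
import HarnessLib

/-!
# Route `LeeYangFibres`, crux `RelativeDimOne` (stmt-Parity-14113), line `single-moebius-split`,
# stub `stub_termBound` — auxiliary file 2: residue classes of a divisibility system and the
# harmonic sum of their moduli

Two elementary inputs of the reduction of term `j ≥ 1` to the single-Möbius hybrid atom:

* `termBound_aux_residue_class` — **one progression**: for moduli `q_i ≥ 1` and non-constant forms
  `a_i n + b_i`, the integers `n` with `q_i ∣ a_i n + b_i` for all `i` form, as soon as one
  solution `n₀` exists, exactly the class `n ≡ n₀ (mod M₀)` with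
  `M₀ = lcm_i (q_i / gcd(a_i, q_i))`;
* `sum_inv_moduli_le` — **harmonic sum of moduli by counting multiples**: if `1 ≤ M(s) ≤ Z` and
  every `n ≥ 1` is a multiple of `M(s)` for at most `C τ(n)^r` indices `s`, then
  `∑_s 1/M(s) ≤ 2C (1 + log Z)^{2^r}` (`1/m ≤ (2/Z) #{n ≤ Z : m ∣ n}` and the tree's
  `∑_{n ≤ Z} τ(n)^r/n ≤ (1 + log Z)^{2^r}`, `Literature.NumberTheory.Sieve.divPowSum_le`);
* small facts on `M₀`: it is `≥ 1`, divides `∏ q_i`, and `M₀ ∣ n` forces `q_i ∣ |a_i| n`.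
-/

noncomputable section

open scoped BigOperators Classical
open Finset

namespace Summit.Parity.GeneralizedHardyLittlewood.Cruxes.RelativeDimOne.SingleMoebiusSplit

/-! ### One divisibility condition -/

/-- For `q ≥ 1`, `a ≠ 0` or not, `g = gcd(a, q)`: `q ∣ a m ↔ (q/g) ∣ m`. -/
theorem natCast_dvd_mul_iff {a : ℤ} {q : ℕ} (hq : 1 ≤ q) (m : ℤ) :
    (q : ℤ) ∣ a * m ↔ ((q / Int.gcd a q : ℕ) : ℤ) ∣ m := by
  set g : ℕ := Int.gcd a q with hg
  have hg0 : 0 < g := Int.gcd_pos_iff.mpr (Or.inr (by exact_mod_cast (show q ≠ 0 by omega)))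
  have hgZ : (g : ℤ) ≠ 0 := by exact_mod_cast hg0.ne'
  have hga : (g : ℤ) ∣ a := Int.gcd_dvd_left a q
  have hgq : (g : ℤ) ∣ (q : ℤ) := Int.gcd_dvd_right a q
  obtain ⟨a', ha'⟩ := hga
  obtain ⟨q', hq'⟩ := hgq
  have hcast : ((q / g : ℕ) : ℤ) = q' := by
    rw [Int.natCast_div, hq', Int.mul_ediv_cancel_left _ hgZ]
  have hcop : Int.gcd q' a' = 1 := by
    have h := Int.gcd_div_gcd_div_gcd (i := (q : ℤ)) (j := a) (by rw [Int.gcd_comm]; exact hg0)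
    rw [Int.gcd_comm (q : ℤ) a, ← hg, hq', ha', Int.mul_ediv_cancel_left _ hgZ,
      Int.mul_ediv_cancel_left _ hgZ] at h
    exact h
  rw [hcast]
  constructor
  · intro h
    rw [hq', ha', mul_assoc] at h
    have h2 : q' ∣ a' * m := (mul_dvd_mul_iff_left hgZ).mp h
    exact Int.dvd_of_dvd_mul_right_of_gcd_one h2 hcop
  · intro h
    rw [hq', ha', mul_assoc]
    exact mul_dvd_mul_left _ (Dvd.dvd.mul_left h a')

/-! ### One progression -/

/-- **One progression** (registered sub-goal for `stub_termBound`). For moduli `q_i ≥ 1`, forms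
`a_i n + b_i`, and a solution `n₀` of the system `q_i ∣ a_i n₀ + b_i` (all `i`): an integer `n`
solves the system iff `M₀ ∣ n − n₀`, where `M₀ = lcm_i (q_i / gcd(a_i, q_i))` (one condition
`q ∣ a n + b` means `q ∣ a (n − n₀)`, i.e. `(q/gcd(a,q)) ∣ n − n₀`; intersect). -/
theorem termBound_aux_residue_class : ∀ (t : ℕ) (a b : Fin t → ℤ) (q : Fin t → ℕ) (n₀ : ℤ),
    (∀ i, 1 ≤ q i) → (∀ i, ((q i : ℕ) : ℤ) ∣ a i * n₀ + b i) →
    ∀ n : ℤ, (∀ i, ((q i : ℕ) : ℤ) ∣ a i * n + b i) ↔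
      ((Finset.univ.lcm (fun i => q i / Int.gcd (a i) (q i)) : ℕ) : ℤ) ∣ n - n₀ := by
  intro t a b q n₀ hq h₀ n
  have hstep : ∀ i, ((q i : ℕ) : ℤ) ∣ a i * n + b i ↔
      ((q i / Int.gcd (a i) (q i) : ℕ) : ℤ) ∣ n - n₀ := by
    intro i
    rw [← natCast_dvd_mul_iff (hq i)]
    constructor
    · intro h
      have := dvd_sub h (h₀ i)
      rwa [show a i * n + b i - (a i * n₀ + b i) = a i * (n - n₀) by ring] at this
    · intro h
      have := dvd_add h (h₀ i)
      rwa [show a i * (n - n₀) + (a i * n₀ + b i) = a i * n + b i by ring] at this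
  simp_rw [hstep, Int.natCast_dvd]
  rw [Finset.lcm_dvd_iff]
  simp

/-! ### The modulus `M₀` -/

/-- `M₀ = lcm_i (q_i / gcd(a_i, q_i)) ≥ 1` when all `q_i ≥ 1`. -/
theorem one_le_lcm_div_gcd {t : ℕ} (a : Fin t → ℤ) {q : Fin t → ℕ} (hq : ∀ i, 1 ≤ q i) :
    1 ≤ Finset.univ.lcm (fun i => q i / Int.gcd (a i) (q i)) := by
  refine Nat.one_le_iff_ne_zero.mpr fun h => ?_
  rw [Finset.lcm_eq_zero_iff] at h
  obtain ⟨i, -, hi⟩ := h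
  have hg0 : 0 < Int.gcd (a i) (q i) :=
    Int.gcd_pos_iff.mpr (Or.inr (by exact_mod_cast (show q i ≠ 0 by have := hq i; omega)))
  have hgq : Int.gcd (a i) (q i) ∣ q i := by
    have := Int.gcd_dvd_right (a i) (q i)
    exact_mod_cast this
  have : 0 < q i / Int.gcd (a i) (q i) := Nat.div_pos (Nat.le_of_dvd (hq i) hgq) hg0
  omega

/-- `M₀ ∣ ∏_i q_i`. -/
theorem lcm_div_gcd_dvd_prod {t : ℕ} (a : Fin t → ℤ) (q : Fin t → ℕ) :
    Finset.univ.lcm (fun i => q i / Int.gcd (a i) (q i)) ∣ ∏ i, q i :=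
  Finset.lcm_dvd fun i _ => (Nat.div_dvd_of_dvd (by
    have := Int.gcd_dvd_right (a i) (q i)
    exact_mod_cast this)).trans (Finset.dvd_prod_of_mem q (Finset.mem_univ i))

/-- `M₀ ∣ n` forces `q_i ∣ |a_i| n` for every `i`. -/
theorem dvd_natAbs_mul_of_lcm_dvd {t : ℕ} (a : Fin t → ℤ) (q : Fin t → ℕ) {n : ℕ}
    (h : Finset.univ.lcm (fun i => q i / Int.gcd (a i) (q i)) ∣ n) (i : Fin t) :
    q i ∣ (a i).natAbs * n := by
  have h1 : q i / Int.gcd (a i) (q i) ∣ n := (Finset.dvd_lcm (Finset.mem_univ i)).trans h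
  have hgq : Int.gcd (a i) (q i) ∣ q i := by
    have := Int.gcd_dvd_right (a i) (q i)
    exact_mod_cast this
  have hga : Int.gcd (a i) (q i) ∣ (a i).natAbs := by
    rw [Int.gcd_eq_natAbs]
    exact Nat.gcd_dvd_left _ _
  rw [← Nat.mul_div_cancel' hgq]
  exact mul_dvd_mul hga h1

/-! ### Harmonic sums of moduli by counting multiples -/

/-- For `1 ≤ m ≤ Z`: `1/m ≤ (2/Z) · #{n ∈ [1, Z] : m ∣ n}` (there are `⌊Z/m⌋ ≥ Z/(2m)` multiples). -/
theorem inv_le_card_multiples {m Z : ℕ} (hm : 1 ≤ m) (hmZ : m ≤ Z) :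
    (1 : ℝ) / m ≤ 2 / Z * (((Finset.Icc 1 Z).filter (fun n => m ∣ n)).card : ℝ) := by
  have hZ : 1 ≤ Z := hm.trans hmZ
  have hZ0 : (0 : ℝ) < Z := by exact_mod_cast hZ
  have hm0 : (0 : ℝ) < m := by exact_mod_cast hm
  set q := Z / m with hq
  have hq1 : 1 ≤ q := (Nat.le_div_iff_mul_le hm).mpr (by simpa using hmZ)
  -- `q` multiples `m, 2m, …, qm` lie in `[1, Z]`
  have hcard : q ≤ ((Finset.Icc 1 Z).filter (fun n => m ∣ n)).card := by
    have himg : (Finset.Icc 1 q).image (fun t => m * t) ⊆ (Finset.Icc 1 Z).filter (fun n => m ∣ n) := by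
      intro n hn
      obtain ⟨t, ht, rfl⟩ := Finset.mem_image.mp hn
      obtain ⟨ht1, htq⟩ := Finset.mem_Icc.mp ht
      refine Finset.mem_filter.mpr ⟨Finset.mem_Icc.mpr ⟨Nat.mul_pos hm ht1, ?_⟩, dvd_mul_right m t⟩
      exact (Nat.mul_le_mul_left m htq).trans (Nat.mul_div_le Z m)
    calc q = (Finset.Icc 1 q).card := by rw [Nat.card_Icc, Nat.add_sub_cancel]
      _ = ((Finset.Icc 1 q).image (fun t => m * t)).card :=
          (Finset.card_image_of_injective _ fun t t' h => Nat.eq_of_mul_eq_mul_left hm h).symm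
      _ ≤ _ := Finset.card_le_card himg
  -- `Z < m (q + 1) ≤ 2 m q`
  have hZq : (Z : ℝ) ≤ 2 * m * q := by
    have h1 : Z < m * (q + 1) := Nat.lt_mul_div_succ Z hm
    have h2 : m * (q + 1) ≤ 2 * m * q := by nlinarith
    exact_mod_cast (h1.le.trans h2)
  have hq' : (q : ℝ) ≤ ((Finset.Icc 1 Z).filter (fun n => m ∣ n)).card := by exact_mod_cast hcard
  rw [div_le_iff₀ hm0]
  calc (1 : ℝ) = 2 / Z * (Z / 2) := by field_simp
    _ ≤ 2 / Z * ((m : ℝ) * q) := by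
        refine mul_le_mul_of_nonneg_left (by linarith) (by positivity)
    _ ≤ 2 / Z * ((((Finset.Icc 1 Z).filter (fun n => m ∣ n)).card : ℝ) * m) := by
        refine mul_le_mul_of_nonneg_left ?_ (by positivity)
        nlinarith
    _ = 2 / Z * (((Finset.Icc 1 Z).filter (fun n => m ∣ n)).card : ℝ) * m := by ring

/-- **Harmonic sum of moduli.** Let `M : S → ℕ` with `1 ≤ M(s) ≤ Z`, and suppose that every
`n ≥ 1` is a multiple of `M(s)` for at most `C τ(n)^r` indices `s ∈ S`. Then
`∑_{s ∈ S} 1/M(s) ≤ 2C (1 + log Z)^{2^r}`: write `1/M(s) ≤ (2/Z) #{n ≤ Z : M(s) ∣ n}`, swap the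
sums, and use `∑_{n ≤ Z} τ(n)^r ≤ Z ∑_{n ≤ Z} τ(n)^r/n ≤ Z (1 + log Z)^{2^r}`
(`Literature.NumberTheory.Sieve.divPowSum_le`). -/
theorem sum_inv_moduli_le {ι : Type*} (S : Finset ι) (M : ι → ℕ) {Z r : ℕ} {C : ℝ} (hC : 0 ≤ C)
    (hM : ∀ s ∈ S, 1 ≤ M s ∧ M s ≤ Z)
    (hcount : ∀ n : ℕ, 1 ≤ n →
      ((S.filter (fun s => M s ∣ n)).card : ℝ) ≤ C * (n.divisors.card : ℝ) ^ r) :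
    ∑ s ∈ S, (1 : ℝ) / M s ≤ 2 * C * (1 + Real.log Z) ^ (2 ^ r) := by
  rcases S.eq_empty_or_nonempty with rfl | hne
  · rw [Finset.sum_empty]
    have := Literature.NumberTheory.Sieve.one_add_log_nonneg Z
    positivity
  obtain ⟨s₀, hs₀⟩ := hne
  have hZ : 1 ≤ Z := (hM s₀ hs₀).1.trans (hM s₀ hs₀).2
  have hZ0 : (0 : ℝ) < Z := by exact_mod_cast hZ
  have hlog := Literature.NumberTheory.Sieve.one_add_log_nonneg Z
  -- Step 1: `1/M(s) ≤ (2/Z) #{n ≤ Z : M s ∣ n}` and swap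
  have h1 : ∑ s ∈ S, (1 : ℝ) / M s ≤
      2 / Z * ∑ n ∈ Finset.Icc 1 Z, ((S.filter (fun s => M s ∣ n)).card : ℝ) := by
    calc ∑ s ∈ S, (1 : ℝ) / M s
        ≤ ∑ s ∈ S, 2 / Z * (((Finset.Icc 1 Z).filter (fun n => M s ∣ n)).card : ℝ) :=
          Finset.sum_le_sum fun s hs => inv_le_card_multiples (hM s hs).1 (hM s hs).2
      _ = 2 / Z * ∑ s ∈ S, (((Finset.Icc 1 Z).filter (fun n => M s ∣ n)).card : ℝ) := by
          rw [Finset.mul_sum]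
      _ = 2 / Z * ∑ n ∈ Finset.Icc 1 Z, ((S.filter (fun s => M s ∣ n)).card : ℝ) := by
          congr 1
          simp only [Finset.card_filter, Nat.cast_sum]
          exact Finset.sum_comm
  -- Step 2: `∑_{n ≤ Z} #{s : M s ∣ n} ≤ C ∑_{n ≤ Z} τ(n)^r ≤ C Z (1 + log Z)^{2^r}`
  have h2 : ∑ n ∈ Finset.Icc 1 Z, ((S.filter (fun s => M s ∣ n)).card : ℝ) ≤
      C * Z * (1 + Real.log Z) ^ (2 ^ r) := by
    calc ∑ n ∈ Finset.Icc 1 Z, ((S.filter (fun s => M s ∣ n)).card : ℝ)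
        ≤ ∑ n ∈ Finset.Icc 1 Z, C * Z * ((n.divisors.card : ℝ) ^ r / n) := by
          refine Finset.sum_le_sum fun n hn => ?_
          obtain ⟨hn1, hnZ⟩ := Finset.mem_Icc.mp hn
          have hn0 : (0 : ℝ) < n := by exact_mod_cast hn1
          have hnZ' : (n : ℝ) ≤ Z := by exact_mod_cast hnZ
          calc ((S.filter (fun s => M s ∣ n)).card : ℝ) ≤ C * (n.divisors.card : ℝ) ^ r :=
                hcount n hn1
            _ = C * n * ((n.divisors.card : ℝ) ^ r / n) := by field_simp
            _ ≤ C * Z * ((n.divisors.card : ℝ) ^ r / n) := by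
                refine mul_le_mul_of_nonneg_right (mul_le_mul_of_nonneg_left hnZ' hC) ?_
                positivity
      _ = C * Z * Literature.NumberTheory.Sieve.divPowSum r Z := by
          rw [← Finset.mul_sum]; rfl
      _ ≤ C * Z * (1 + Real.log Z) ^ (2 ^ r) :=
          mul_le_mul_of_nonneg_left (Literature.NumberTheory.Sieve.divPowSum_le r Z) (by positivity)
  calc ∑ s ∈ S, (1 : ℝ) / M s ≤ 2 / Z * (C * Z * (1 + Real.log Z) ^ (2 ^ r)) :=
        h1.trans (mul_le_mul_of_nonneg_left h2 (by positivity))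
    _ = 2 * C * (1 + Real.log Z) ^ (2 ^ r) := by field_simp

end Summit.Parity.GeneralizedHardyLittlewood.Cruxes.RelativeDimOne.SingleMoebiusSplit
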